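import Mathlib.LinearAlgebra.BilinearForm.Basic
import Mathlib.LinearAlgebra.Dimension.Finrank
import Mathlib.LinearAlgebra.FiniteDimensional.Lemmas
import Mathlib.LinearAlgebra.Dimension.Constructions
import Mathlib.LinearAlgebra.Dual.Lemmas
import Mathlib.Algebra.BigOperators.Fin
import Mathlib.Tactic.Ring
import HarnessLib

/-!
# Golyshev–Lunts–Orlov, Lemma 9.6.2: a complex structure preserving a symplectic form admits a Lagrangian `W`
# with `JW ∩ W = 0` (inductive frame construction, any field with `2 ≠ 0`) + the Lemma 9.4.1 2) ⟺ 3) link of p. 30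

Venture cell `pub-hsemireg`, literature seat `lit-w-polishchuk-orlov` (g14, 2026-08-25). Companion of
`GolyshevLuntsOrlovDualTori.lean` and `GolyshevLuntsOrlovIomega.lean` (not imported). Unlike those block-matrix legs,
this file proves the EXISTENCE statement of [GLO01] §9.6 coordinate-free (Mathlib `LinearMap.BilinForm`, `Submodule`).

PRINTED ([GolyshevLuntsOrlov2001MirrorAV] = Golyshev–Lunts–Orlov, «Mirror symmetry for abelian varieties», J. Algebraic
Geom. 10 (2001) 433–496; arXiv math/9812003v2 p. 30, text layer `widen/LIT-W/texts-po/glo01v2/p0030.num.txt`, page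
images `renders/glo01eye-g12/glo01v2_p30a/b.png`):
* proof of Prop. 9.6.1, p. 30 L25–41: «By Lemma 9.4.1 in order for `ω_E` to exist the symmetric bilinear form
  `Q_ℝ(I_{ω_A}J_{A×Â}(·), ·)` must be nondegenerate on `Λ_{2,ℝ}`. This is equivalent to the statement that
  `J_{A×Â}Λ_{2,ℝ} ∩ Λ_{2,ℝ} = 0`. Put `W := ⊕ℝe₋ᵢ`. Then since `J_{A×Â}` preserves the form `Q_ℝ` the last equality is
  equivalent to `J_{A×Â}W ∩ W = 0`. (∗) … it suffices to prove the following lemma»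
* LEMMA 9.6.2 (p. 30 L46–60): «Let `V ≅ ℝ^{2n}` be a real vector space with a nondegenerate symplectic form `φ`. Let
  `J ∈ End(V)` be a complex structure on `V`, which preserves `φ`. Then there exists a maximal `φ`–isotropic subspace
  `W ⊂ V` such that `JW ∩ W = 0`.»
* PROOF (p. 30 L61–89): «Note that the form `φ(J·, ·)` on `V` is symmetric and nondegenerate. We will choose elements
  `x₁, ..., x_n ∈ V` such that `W := ⊕ℝx_i` has the desired properties by induction on `i`. Choose `x₁` such that
  `φ(Jx₁, x₁) ≠ 0`. Let `V = < x₁, Jx₁ > ⊕ V′` be a `φ`-orthogonal decomposition. Note that `V′` is `J`–invariant. Hence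
  we may replace `V` by `V′` and choose `x₂ ∈ V′` s.t. `φ(Jx₂, x₂) ≠ 0`. And so on. Cleary [sic] the resulting space
  `W = ⊕ℝx_i` is maximal `φ`-isotropic and `JW ∩ W = 0`. This proves the lemma and the Proposition 9.6.1.»

MODEL ∕ GENERALITY: `K` any field with `(2 : K) ≠ 0` (print: `ℝ`); `finrank K V = 2n`; «nondegenerate symplectic
form» = bilinear `φ` with `φ(x, x) = 0 ∀ x` and `∀ x ≠ 0, ∃ y, φ(x, y) ≠ 0`; «complex structure which preserves `φ`» =
`J : V →ₗ[K] V`, `J(Jx) = −x`, `φ(Jx, Jy) = φ(x, y)`; «maximal `φ`-isotropic» = isotropic of dimension `n` AND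
`dim W′ ≤ n` for every isotropic `W′` (proved: `two_mul_finrank_le_of_isotropic`); «`JW ∩ W = 0`» = `W.map J ⊓ W = ⊥`.

## Results (PROVED; theorems only — no definition, no named fact, no `sorry`; imports Mathlib + HarnessLib)
* `skew_of_alt`, `phiJ_left`, `psi_symm` («`φ(J·, ·)` is symmetric»); `sum_pair_eq_single`, `sum_pair_eq_zero`,
  `pair_sum_eq_zero`; `compl_J_stable` («`V′` is `J`–invariant»); **`frame_extend`** — the inductive step: given
  `x₀ … x_{k−1}` with `φ(x_i, x_j) = 0`, `φ(x_i, Jx_j) = 0 (i ≠ j)`, `φ(Jx_i, x_i) ≠ 0` and `2k < dim V`, there is `w`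
  orthogonal to all `x_i, Jx_i` with `φ(Jw, w) ≠ 0` (a nonzero `u` in the common orthogonal `U` by
  `LinearMap.ker_ne_bot_of_finrank_lt`; nondegeneracy inside `U` by the projection `y ↦ y − Σ[φ(y, Jx_i)∕φ(x_i,
  Jx_i)]x_i − Σ[φ(y, x_i)∕φ(Jx_i, x_i)]Jx_i` in place of the printed `V = <x₁, Jx₁> ⊕ V′`; then POLARIZATION of
  `φ(J·, ·)` on `U` — the only use of `2 ≠ 0`); `frame_succ`; **`exists_frame`** («by induction on `i`»).
* `restrictPairing_surjective`, `mem_ker_restrictPairing`, `two_mul_finrank_le_of_isotropic` [folklore: `2 · dim W ≤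
  dim V` for isotropic `W`], `mem_of_orthogonal_lagrangian` (`W^⊥ = W` for Lagrangian `W`),
  **`nondegenerateOn_iff_map_inf_eq_bot`** («`φ(J·, ·)|_W` non-degenerate» ⟺ «`JW ∩ W = 0`» for Lagrangian `W`,
  `J² = −1`: the Lemma 9.4.1 2) ⟺ 3) link of p. 30 L33–35, DERIVED, `J` need not preserve `φ`) and
  `nondegenerateOn_comp_iff` (the printed factor `I_{ω_A}` does not change the radical).
* **`exists_lagrangian_inf_map_eq_bot`** = LEMMA 9.6.2 in the model: **there is `W ≤ V` with `finrank K W = n`,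
  `φ(a, b) = 0` for `a, b ∈ W`, `W.map J ⊓ W = ⊥`, and `finrank K W′ ≤ finrank K W` for every isotropic `W′`**
  (`W = span{x₀, …, x_{n−1}}` of a full frame); `example_plane`: the hypotheses are inhabited (`ℚ × ℚ`, `n = 1`).

HONEST FRAMING: linear algebra only; NOT formalised: the second link of p. 30 L37–40 («since `J_{A×Â}` preserves
`Q_ℝ`» ⟹ (∗) for `W ⊂ V_A`, via `Λ₂ = W ⊕ W′`) and the Zariski-density ∕ transitivity paragraph feeding 9.6.2 into
Prop. 9.6.1 (`Sp(Γ_A, φ; ℤ)`); nothing here constructs a torus, a mirror pair or an abelian variety, or says HC holds.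
-/

namespace Summit.Ventures.HSemireg.GolyshevLuntsOrlovLagrangian

open Module Submodule

variable {K : Type*} [Field K] {V : Type*} [AddCommGroup V] [Module K V]

section Frame

variable (φ : LinearMap.BilinForm K V) (J : V →ₗ[K] V)

/-- An alternating form is skew: `φ x y = −φ y x`. -/
theorem skew_of_alt (halt : ∀ x, φ x x = 0) (x y : V) : φ x y = -φ y x := by
  have h := halt (x + y)
  simp only [map_add, LinearMap.add_apply, halt x, halt y, zero_add, add_zero] at h
  exact eq_neg_of_add_eq_zero_right h

/-- `φ (J x) y = −φ x (J y)` for `J² = −1` preserving `φ`. -/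
theorem phiJ_left (hJ : ∀ x, J (J x) = -x) (hJφ : ∀ x y, φ (J x) (J y) = φ x y) (x y : V) :
    φ (J x) y = -φ x (J y) := by
  have h := hJφ x (J y)
  rw [hJ, map_neg] at h
  exact neg_eq_iff_eq_neg.mp h

/-- The form `ψ(x, y) = φ(Jx, y)` is symmetric («the form `φ(J·, ·)` on `V` is symmetric»). -/
theorem psi_symm (halt : ∀ x, φ x x = 0) (hJ : ∀ x, J (J x) = -x) (hJφ : ∀ x y, φ (J x) (J y) = φ x y)
    (x y : V) : φ (J x) y = φ (J y) x := by
  rw [phiJ_left φ J hJ hJφ, skew_of_alt φ halt x (J y), neg_neg]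

/-- Pairing a finite combination on the left with a vector orthogonal to all but one term. -/
theorem sum_pair_eq_single {ι : Type*} (s : Finset ι) (v : ι → V) (a : ι → K) (z : V) {j : ι}
    (hj : j ∈ s) (h0 : ∀ i ∈ s, i ≠ j → φ (v i) z = 0) :
    φ (∑ i ∈ s, a i • v i) z = a j * φ (v j) z := by
  rw [map_sum, LinearMap.sum_apply]
  rw [Finset.sum_eq_single j (fun i hi hij => ?_) (fun h => (h hj).elim)]
  · rw [map_smul, LinearMap.smul_apply, smul_eq_mul]
  · rw [map_smul, LinearMap.smul_apply, h0 i hi hij, smul_zero]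

/-- Pairing a finite combination on the left with a vector orthogonal to every term. -/
theorem sum_pair_eq_zero {ι : Type*} (s : Finset ι) (v : ι → V) (a : ι → K) (z : V)
    (h0 : ∀ i ∈ s, φ (v i) z = 0) : φ (∑ i ∈ s, a i • v i) z = 0 := by
  rw [map_sum, LinearMap.sum_apply]
  exact Finset.sum_eq_zero fun i hi => by rw [map_smul, LinearMap.smul_apply, h0 i hi, smul_zero]

/-- Pairing on the right with a finite combination of vectors orthogonal to the left argument. -/
theorem pair_sum_eq_zero {ι : Type*} (s : Finset ι) (v : ι → V) (a : ι → K) (u : V)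
    (h0 : ∀ i ∈ s, φ u (v i) = 0) : φ u (∑ i ∈ s, a i • v i) = 0 := by
  rw [map_sum]
  exact Finset.sum_eq_zero fun i hi => by rw [map_smul, h0 i hi, smul_zero]

/-- `J` preserves the common orthogonal `U = {v ∣ φ(v, x_i) = 0 = φ(v, Jx_i), i < k}` of a frame («`V′` is
`J`–invariant»). -/
theorem compl_J_stable (hJ : ∀ x, J (J x) = -x) (hJφ : ∀ x y, φ (J x) (J y) = φ x y) {x : ℕ → V} {k : ℕ}
    {v : V} (hv : ∀ i < k, φ v (x i) = 0 ∧ φ v (J (x i)) = 0) :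
    ∀ i < k, φ (J v) (x i) = 0 ∧ φ (J v) (J (x i)) = 0 :=
  fun i hi => ⟨by rw [phiJ_left φ J hJ hJφ, (hv i hi).2, neg_zero], by rw [hJφ, (hv i hi).1]⟩

/-- **The inductive step** («Hence we may replace `V` by `V′` and choose `x₂ ∈ V′` s.t. `φ(Jx₂, x₂) ≠ 0`»): given a
frame `x₀ … x_{k−1}` with `2k < dim V`, there is `w` orthogonal to all `x_i`, `Jx_i` with `φ(Jw, w) ≠ 0`. -/
theorem frame_extend [FiniteDimensional K V] (h2 : (2 : K) ≠ 0) (halt : ∀ x, φ x x = 0)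
    (hnd : ∀ x : V, x ≠ 0 → ∃ y, φ x y ≠ 0) (hJ : ∀ x, J (J x) = -x) (hJφ : ∀ x y, φ (J x) (J y) = φ x y)
    {k : ℕ} (hk : 2 * k < finrank K V) {x : ℕ → V} (hF1 : ∀ i < k, ∀ j < k, φ (x i) (x j) = 0)
    (hF2 : ∀ i < k, ∀ j < k, i ≠ j → φ (x i) (J (x j)) = 0) (hF3 : ∀ i < k, φ (J (x i)) (x i) ≠ 0) :
    ∃ w : V, (∀ i < k, φ w (x i) = 0 ∧ φ w (J (x i)) = 0) ∧ φ (J w) w ≠ 0 := by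
  -- (B1) a nonzero vector `u` orthogonal to the frame: dimension count
  let f : V →ₗ[K] (Fin k ⊕ Fin k → K) :=
    LinearMap.pi (fun s => Sum.elim (fun i : Fin k => φ.flip (x i)) (fun i : Fin k => φ.flip (J (x i))) s)
  have hU : ∀ v, v ∈ LinearMap.ker f ↔ ∀ i < k, φ v (x i) = 0 ∧ φ v (J (x i)) = 0 := by
    intro v
    rw [LinearMap.mem_ker, funext_iff]
    simp only [f, LinearMap.pi_apply, Sum.forall, Sum.elim_inl, Sum.elim_inr, Pi.zero_apply]
    constructor
    · rintro ⟨ha, hb⟩ i hi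
      exact ⟨ha ⟨i, hi⟩, hb ⟨i, hi⟩⟩
    · intro h
      exact ⟨fun i => (h i i.2).1, fun i => (h i i.2).2⟩
  have hker : LinearMap.ker f ≠ ⊥ := LinearMap.ker_ne_bot_of_finrank_lt (by
    rw [Module.finrank_fintype_fun_eq_card, Fintype.card_sum, Fintype.card_fin]; omega)
  obtain ⟨u, huU, hu0⟩ := Submodule.exists_mem_ne_zero_of_ne_bot hker
  rw [hU] at huU
  -- (B2) nondegeneracy inside `U`: project a witness `y` along the frame
  obtain ⟨y, hy⟩ := hnd u hu0
  set c : ℕ → K := fun i => φ y (J (x i)) / φ (x i) (J (x i)) with hc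
  set d : ℕ → K := fun i => φ y (x i) / φ (J (x i)) (x i) with hd
  set y' : V := y - ∑ i ∈ Finset.range k, c i • x i - ∑ i ∈ Finset.range k, d i • J (x i) with hy'
  have hxJx : ∀ j < k, φ (x j) (J (x j)) ≠ 0 := fun j hj => by
    rw [skew_of_alt φ halt, neg_ne_zero]; exact hF3 j hj
  have hy'U : ∀ j < k, φ y' (x j) = 0 ∧ φ y' (J (x j)) = 0 := by
    intro j hj
    have hjr : j ∈ Finset.range k := Finset.mem_range.mpr hj
    refine ⟨?_, ?_⟩
    · rw [hy', map_sub, map_sub, LinearMap.sub_apply, LinearMap.sub_apply,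
        sum_pair_eq_zero φ _ _ _ _ (fun i hi => hF1 i (Finset.mem_range.mp hi) j hj),
        sum_pair_eq_single φ _ (fun i => J (x i)) _ _ hjr (fun i hi hij => by
          rw [phiJ_left φ J hJ hJφ, hF2 i (Finset.mem_range.mp hi) j hj hij, neg_zero]),
        hd, div_mul_cancel₀ _ (hF3 j hj), sub_zero, sub_self]
    · rw [hy', map_sub, map_sub, LinearMap.sub_apply, LinearMap.sub_apply,
        sum_pair_eq_single φ _ _ _ _ hjr (fun i hi hij => hF2 i (Finset.mem_range.mp hi) j hj hij),
        sum_pair_eq_zero φ _ (fun i => J (x i)) _ _ (fun i hi => by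
          rw [hJφ, hF1 i (Finset.mem_range.mp hi) j hj]),
        hc, div_mul_cancel₀ _ (hxJx j hj), sub_self, zero_sub, neg_eq_zero]
  have huy' : φ u y' ≠ 0 := by
    rw [hy', map_sub, map_sub, pair_sum_eq_zero φ _ _ _ _ (fun i hi => (huU i (Finset.mem_range.mp hi)).1),
      pair_sum_eq_zero φ _ (fun i => J (x i)) _ _ (fun i hi => (huU i (Finset.mem_range.mp hi)).2),
      sub_zero, sub_zero]
    exact hy
  -- (B3) a non-isotropic vector for `ψ = φ(J·, ·)` inside `U`, by polarization (here `2 ≠ 0` is used)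
  by_contra hcon
  have hz : ∀ w, (∀ i < k, φ w (x i) = 0 ∧ φ w (J (x i)) = 0) → φ (J w) w = 0 :=
    fun w hw => Classical.byContradiction fun hne => hcon ⟨w, hw, hne⟩
  have hJuU := compl_J_stable φ J hJ hJφ huU
  have habU : ∀ i < k, φ (J u + y') (x i) = 0 ∧ φ (J u + y') (J (x i)) = 0 := fun i hi => by
    constructor
    · rw [map_add, LinearMap.add_apply, (hJuU i hi).1, (hy'U i hi).1, add_zero]
    · rw [map_add, LinearMap.add_apply, (hJuU i hi).2, (hy'U i hi).2, add_zero]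
  have h0 := hz (J u + y') habU
  have hexp : φ (J (J u + y')) (J u + y') =
      φ (J (J u)) (J u) + φ (J y') y' + (φ (J (J u)) y' + φ (J y') (J u)) := by
    simp only [map_add, LinearMap.add_apply]; ring
  rw [hexp, hz (J u) hJuU, hz y' hy'U, zero_add, zero_add, psi_symm φ J halt hJ hJφ y' (J u), ← two_mul,
    mul_eq_zero, hJ, map_neg, LinearMap.neg_apply, neg_eq_zero] at h0
  rcases h0 with h0 | h0
  · exact h2 h0
  · exact huy' h0

/-- Appending the new vector gives a frame of length `k + 1`. -/
theorem frame_succ (halt : ∀ x, φ x x = 0) (hJ : ∀ x, J (J x) = -x) (hJφ : ∀ x y, φ (J x) (J y) = φ x y)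
    {k : ℕ} {x : ℕ → V} (hF1 : ∀ i < k, ∀ j < k, φ (x i) (x j) = 0)
    (hF2 : ∀ i < k, ∀ j < k, i ≠ j → φ (x i) (J (x j)) = 0) (hF3 : ∀ i < k, φ (J (x i)) (x i) ≠ 0)
    {w : V} (hwU : ∀ i < k, φ w (x i) = 0 ∧ φ w (J (x i)) = 0) (hw : φ (J w) w ≠ 0) :
    (∀ i < k + 1, ∀ j < k + 1, φ (Function.update x k w i) (Function.update x k w j) = 0) ∧
    (∀ i < k + 1, ∀ j < k + 1, i ≠ j → φ (Function.update x k w i) (J (Function.update x k w j)) = 0) ∧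
    (∀ i < k + 1, φ (J (Function.update x k w i)) (Function.update x k w i) ≠ 0) := by
  have hxw : ∀ i < k, φ (x i) w = 0 := fun i hi => by rw [skew_of_alt φ halt, (hwU i hi).1, neg_zero]
  have hxJw : ∀ i < k, φ (x i) (J w) = 0 := fun i hi => by
    rw [skew_of_alt φ halt, phiJ_left φ J hJ hJφ, (hwU i hi).2, neg_zero, neg_zero]
  refine ⟨?_, ?_, ?_⟩
  · intro i hi j hj
    rcases Nat.lt_succ_iff_lt_or_eq.mp hi with hi | rfl <;> rcases Nat.lt_succ_iff_lt_or_eq.mp hj with hj | rfl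
    · rw [Function.update_of_ne (Nat.ne_of_lt hi), Function.update_of_ne (Nat.ne_of_lt hj)]; exact hF1 i hi j hj
    · rw [Function.update_of_ne (Nat.ne_of_lt hi), Function.update_self]; exact hxw i hi
    · rw [Function.update_self, Function.update_of_ne (Nat.ne_of_lt hj)]; exact (hwU j hj).1
    · rw [Function.update_self]; exact halt w
  · intro i hi j hj hij
    rcases Nat.lt_succ_iff_lt_or_eq.mp hi with hi | rfl <;> rcases Nat.lt_succ_iff_lt_or_eq.mp hj with hj | rfl
    · rw [Function.update_of_ne (Nat.ne_of_lt hi), Function.update_of_ne (Nat.ne_of_lt hj)]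
      exact hF2 i hi j hj hij
    · rw [Function.update_of_ne (Nat.ne_of_lt hi), Function.update_self]; exact hxJw i hi
    · rw [Function.update_self, Function.update_of_ne (Nat.ne_of_lt hj)]; exact (hwU j hj).2
    · exact (hij rfl).elim
  · intro i hi
    rcases Nat.lt_succ_iff_lt_or_eq.mp hi with hi | rfl
    · rw [Function.update_of_ne (Nat.ne_of_lt hi)]; exact hF3 i hi
    · rw [Function.update_self]; exact hw

/-- **Frames exist** («We will choose elements `x₁, ..., x_n ∈ V` … by induction on `i`»): for every `k ≤ n`,
`dim V = 2n`, there are `x₀ … x_{k−1}` with `φ(x_i, x_j) = 0`, `φ(x_i, Jx_j) = 0 (i ≠ j)`, `φ(Jx_i, x_i) ≠ 0`. -/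
theorem exists_frame [FiniteDimensional K V] (h2 : (2 : K) ≠ 0) (halt : ∀ x, φ x x = 0)
    (hnd : ∀ x : V, x ≠ 0 → ∃ y, φ x y ≠ 0) (hJ : ∀ x, J (J x) = -x) (hJφ : ∀ x y, φ (J x) (J y) = φ x y)
    {n : ℕ} (hdim : finrank K V = 2 * n) :
    ∀ k ≤ n, ∃ x : ℕ → V, (∀ i < k, ∀ j < k, φ (x i) (x j) = 0) ∧
      (∀ i < k, ∀ j < k, i ≠ j → φ (x i) (J (x j)) = 0) ∧ (∀ i < k, φ (J (x i)) (x i) ≠ 0) := by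
  intro k
  induction k with
  | zero =>
    exact fun _ => ⟨0, fun i hi => (Nat.not_lt_zero i hi).elim, fun i hi => (Nat.not_lt_zero i hi).elim,
      fun i hi => (Nat.not_lt_zero i hi).elim⟩
  | succ k ih =>
    intro hk
    obtain ⟨x, hF1, hF2, hF3⟩ := ih (Nat.le_of_succ_le hk)
    have hk' : 2 * k < finrank K V := by rw [hdim]; omega
    obtain ⟨w, hwU, hw⟩ := frame_extend φ J h2 halt hnd hJ hJφ hk' hF1 hF2 hF3
    exact ⟨Function.update x k w, frame_succ φ J halt hJ hJφ hF1 hF2 hF3 hwU hw⟩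

/-- Nondegeneracy makes `v ↦ φ(v, ·)|_W` SURJECTIVE onto the dual of `W` (every functional on `W` extends to `V`,
and `v ↦ φ(v, ·)` is onto `V*` by injectivity + equal dimension). -/
theorem restrictPairing_surjective [FiniteDimensional K V] (hnd : ∀ x : V, x ≠ 0 → ∃ y, φ x y ≠ 0)
    (W : Submodule K V) :
    Function.Surjective (W.dualRestrict ∘ₗ (φ : V →ₗ[K] Module.Dual K V)) := by
  have hinj : Function.Injective (φ : V →ₗ[K] Module.Dual K V) := by
    intro x y hxy
    by_contra hne
    obtain ⟨z, hz⟩ := hnd (x - y) (sub_ne_zero.mpr hne)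
    apply hz
    rw [map_sub, LinearMap.sub_apply, hxy, sub_self]
  have hsurj : Function.Surjective (φ : V →ₗ[K] Module.Dual K V) :=
    (LinearMap.injective_iff_surjective_of_finrank_eq_finrank Subspace.dual_finrank_eq.symm).mp hinj
  exact Subspace.dualRestrict_surjective.comp hsurj

/-- The kernel of `v ↦ φ(v, ·)|_W` is the (left) `φ`-orthogonal of `W`. -/
theorem mem_ker_restrictPairing (W : Submodule K V) (v : V) :
    v ∈ LinearMap.ker (W.dualRestrict ∘ₗ (φ : V →ₗ[K] Module.Dual K V)) ↔ ∀ w ∈ W, φ v w = 0 := by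
  rw [LinearMap.mem_ker]
  refine ⟨fun h w hw => ?_, fun h => LinearMap.ext fun w => ?_⟩
  · simpa only [LinearMap.coe_comp, Function.comp_apply, Submodule.dualRestrict_apply, LinearMap.zero_apply]
      using LinearMap.congr_fun h ⟨w, hw⟩
  · simp only [LinearMap.coe_comp, Function.comp_apply, Submodule.dualRestrict_apply, LinearMap.zero_apply]
    exact h w w.2

/-- **Dimension bound for isotropic subspaces** (what makes an `n`-dimensional isotropic `W` «maximal
`φ`-isotropic»): if `φ` is nondegenerate (`∀ x ≠ 0, ∃ y, φ(x, y) ≠ 0`) and `φ` vanishes on `W × W`, then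
`2 · dim W ≤ dim V`: the kernel of the surjection `v ↦ φ(v, ·)|_W` contains `W`. [folklore; used here only to read
«maximal» in Lemma 9.6.2] -/
theorem two_mul_finrank_le_of_isotropic [FiniteDimensional K V] (hnd : ∀ x : V, x ≠ 0 → ∃ y, φ x y ≠ 0)
    (W : Submodule K V) (hW : ∀ a ∈ W, ∀ b ∈ W, φ a b = 0) :
    2 * finrank K W ≤ finrank K V := by
  set r := W.dualRestrict ∘ₗ (φ : V →ₗ[K] Module.Dual K V) with hr'
  have hrange : finrank K (LinearMap.range r) = finrank K W := by
    rw [LinearMap.range_eq_top.mpr (restrictPairing_surjective φ hnd W), finrank_top, Subspace.dual_finrank_eq]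
  have hker : finrank K W ≤ finrank K (LinearMap.ker r) :=
    Submodule.finrank_mono fun a ha => (mem_ker_restrictPairing φ W a).mpr (hW a ha)
  rw [two_mul, ← LinearMap.finrank_range_add_finrank_ker r, hrange]
  exact Nat.add_le_add_left hker _

/-- For a LAGRANGIAN `W` (isotropic of half dimension) the `φ`-orthogonal of `W` is `W` itself:
`(∀ w ∈ W, φ(v, w) = 0) → v ∈ W`. -/
theorem mem_of_orthogonal_lagrangian [FiniteDimensional K V] (hnd : ∀ x : V, x ≠ 0 → ∃ y, φ x y ≠ 0)
    (W : Submodule K V) (hW : ∀ a ∈ W, ∀ b ∈ W, φ a b = 0)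
    {n : ℕ} (hdim : finrank K V = 2 * n) (hWn : finrank K W = n) {v : V} (hv : ∀ w ∈ W, φ v w = 0) :
    v ∈ W := by
  set r := W.dualRestrict ∘ₗ (φ : V →ₗ[K] Module.Dual K V) with hr'
  have hrange : finrank K (LinearMap.range r) = finrank K W := by
    rw [LinearMap.range_eq_top.mpr (restrictPairing_surjective φ hnd W), finrank_top, Subspace.dual_finrank_eq]
  have hle : W ≤ LinearMap.ker r := fun a ha => (mem_ker_restrictPairing φ W a).mpr (hW a ha)
  have hsum := LinearMap.finrank_range_add_finrank_ker r
  have heq : W = LinearMap.ker r := Submodule.eq_of_le_of_finrank_eq hle (by omega)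
  rw [heq]
  exact (mem_ker_restrictPairing φ W v).mpr hv

/-- **Lemma 9.4.1 2) ⟺ 3) ∕ p. 30 L33–35, coordinate-free**: for ANY nondegenerate bilinear `φ` (printed use: the
SYMMETRIC `Q_ℝ`; inside this section `φ` is otherwise the symplectic form), a Lagrangian `W` (isotropic, half
dimension) and any `J` with `J² = −1`: «`φ(J·, ·)|_W` non-degenerate» ⟺ «`JW ∩ W = 0`» — the FIRST link of the
printed chain «`Q_ℝ(I_{ω_A}J_{A×Â}(·), ·)` … nondegenerate on `Λ_{2,ℝ}`. This is equivalent to the statement that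
`J_{A×Â}Λ_{2,ℝ} ∩ Λ_{2,ℝ} = 0`» (instances: `(Λ_ℝ, Q_ℝ, Λ_{2,ℝ}, J_{A×Â})`; `(Λ_ℝ, Q, V_Â, I)` = Lemma 9.4.1;
`(V_A, φ, W, J_A)` = the seat's READING (r3)); the factor `I_{ω_A}` is removed by `nondegenerateOn_comp_iff`; the
SECOND link «since `J_{A×Â}` preserves `Q_ℝ` … equivalent to `J_{A×Â}W ∩ W = 0` (∗)» (p. 30 L37–40, `Λ₂ = W ⊕ W′`,
`J_Â = −J_Aᵀ`) is NOT formalised [cite: GolyshevLuntsOrlov2001MirrorAV, proof of Prop. 9.6.1 (arXiv v2 p. 30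
L25–41); Lemma 9.4.1 2) ⟺ 3) (p. 27)]. DERIVED HERE (neither direction uses that `J` preserves `φ`; `⇐` uses
`W^⊥ = W`). -/
theorem nondegenerateOn_iff_map_inf_eq_bot [FiniteDimensional K V] (hnd : ∀ x : V, x ≠ 0 → ∃ y, φ x y ≠ 0)
    (hJ : ∀ x, J (J x) = -x) (W : Submodule K V)
    (hW : ∀ a ∈ W, ∀ b ∈ W, φ a b = 0) {n : ℕ} (hdim : finrank K V = 2 * n) (hWn : finrank K W = n) :
    (∀ w ∈ W, (∀ w' ∈ W, φ (J w) w' = 0) → w = 0) ↔ W.map J ⊓ W = ⊥ := by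
  refine ⟨fun h => eq_bot_iff.mpr fun v hv => ?_, fun h w hw hzero => ?_⟩
  · rw [mem_inf, mem_map] at hv
    obtain ⟨⟨w₀, hw₀, rfl⟩, hJw₀⟩ := hv
    rw [mem_bot, h w₀ hw₀ (fun w' hw' => hW (J w₀) hJw₀ w' hw'), map_zero]
  · have hJw : J w ∈ W := mem_of_orthogonal_lagrangian φ hnd W hW hdim hWn hzero
    have hJw0 : J w = 0 := (mem_bot K).mp (h ▸ mem_inf.mpr ⟨mem_map.mpr ⟨w, hw, rfl⟩, hJw⟩)
    have := hJ w
    rw [hJw0, map_zero] at this; exact neg_eq_zero.mp this.symm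

/-- The printed form is `Q_ℝ(I_{ω_A}J_{A×Â}(·), ·)` with the extra factor `I = I_{ω_A}`, which preserves `Q_ℝ` (p. 27
L107) and `Λ_{2,ℝ}` (p. 30 L3–6): for `I` preserving `φ` and mapping `W` ONTO `W`, `φ(IJ·, ·)|_W` and `φ(J·, ·)|_W`
have the same radical, so either reads «non-degenerate on `W`» [bridge lemma; DERIVED, not printed]. -/
theorem nondegenerateOn_comp_iff (I : V →ₗ[K] V) (hI : ∀ u v, φ (I u) (I v) = φ u v) (W : Submodule K V)
    (hIW : ∀ w ∈ W, I w ∈ W) (hIW' : ∀ w ∈ W, ∃ w₀ ∈ W, I w₀ = w) :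
    (∀ w ∈ W, (∀ w' ∈ W, φ (I (J w)) w' = 0) → w = 0) ↔ (∀ w ∈ W, (∀ w' ∈ W, φ (J w) w' = 0) → w = 0) := by
  refine forall₂_congr fun w _ => ⟨fun h hz => h fun w' hw' => ?_, fun h hz => h fun w' hw' => ?_⟩
  · obtain ⟨w₀, hw₀, rfl⟩ := hIW' w' hw'
    rw [hI, hz w₀ hw₀]
  · rw [← hI, hz (I w') (hIW w' hw')]

/-- **[GLO01] LEMMA 9.6.2** (over any field with `2 ≠ 0`): for a nondegenerate alternating form `φ` on `V`,
`dim V = 2n`, and `J` with `J² = −1` preserving `φ`, there is an `n`-dimensional `φ`-isotropic subspace `W`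
(a maximal isotropic = Lagrangian one) with `W ∩ JW = 0`. -/
theorem exists_lagrangian_inf_map_eq_bot [FiniteDimensional K V] (h2 : (2 : K) ≠ 0) (halt : ∀ x, φ x x = 0)
    (hnd : ∀ x : V, x ≠ 0 → ∃ y, φ x y ≠ 0) (hJ : ∀ x, J (J x) = -x) (hJφ : ∀ x y, φ (J x) (J y) = φ x y)
    {n : ℕ} (hdim : finrank K V = 2 * n) :
    ∃ W : Submodule K V, finrank K W = n ∧ (∀ a ∈ W, ∀ b ∈ W, φ a b = 0) ∧ W.map J ⊓ W = ⊥ ∧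
      ∀ W' : Submodule K V, (∀ a ∈ W', ∀ b ∈ W', φ a b = 0) → finrank K W' ≤ finrank K W := by
  obtain ⟨x, hF1, hF2, hF3⟩ := exists_frame φ J h2 halt hnd hJ hJφ hdim n le_rfl
  let b : Fin n → V := fun i => x i
  have hbJb : ∀ (s : Finset (Fin n)) (g : Fin n → K) (j : Fin n), j ∈ s →
      φ (∑ i ∈ s, g i • b i) (J (b j)) = g j * φ (x j) (J (x j)) := fun s g j hj =>
    sum_pair_eq_single φ s b g _ hj (fun i _ hij => hF2 i i.2 j j.2 (fun h => hij (Fin.ext h)))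
  have hxJx : ∀ j < n, φ (x j) (J (x j)) ≠ 0 := fun j hj => by
    rw [skew_of_alt φ halt, neg_ne_zero]; exact hF3 j hj
  have hli : LinearIndependent K b := linearIndependent_iff'.mpr fun s g hs j hj => by
    have h := hbJb s g j hj
    rw [hs, map_zero, LinearMap.zero_apply] at h
    exact (mul_eq_zero.mp h.symm).resolve_right (hxJx j j.2)
  have hWn : finrank K (span K (Set.range b)) = n := by rw [finrank_span_eq_card hli, Fintype.card_fin]
  refine ⟨span K (Set.range b), hWn, ?_, ?_, fun W' hW' => ?_⟩
  · intro a ha a' ha'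
    obtain ⟨ca, rfl⟩ := mem_span_range_iff_exists_fun K |>.mp ha
    obtain ⟨ca', rfl⟩ := mem_span_range_iff_exists_fun K |>.mp ha'
    exact sum_pair_eq_zero φ _ _ _ _ (fun i _ =>
      pair_sum_eq_zero φ _ _ _ _ (fun j _ => hF1 i i.2 j j.2))
  · rw [inf_comm, eq_bot_iff]; intro w hw; rw [mem_inf, mem_map] at hw
    obtain ⟨hwW, w', hw'W, rfl⟩ := hw
    obtain ⟨cw, hcw⟩ := mem_span_range_iff_exists_fun K |>.mp hwW
    obtain ⟨c', rfl⟩ := mem_span_range_iff_exists_fun K |>.mp hw'W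
    rw [mem_bot]
    suffices hc' : ∀ j, c' j = 0 by
      simp only [hc', zero_smul, Finset.sum_const_zero, map_zero]
    intro j
    -- pair `J w' = w` with `x_j`: the left side gives `c'_j φ(Jx_j, x_j)`, the right side `0`
    have hl : φ (J (∑ i, c' i • b i)) (b j) = c' j * φ (J (x j)) (x j) := by
      rw [map_sum]
      simp only [map_smul]
      exact sum_pair_eq_single φ _ (fun i => J (b i)) c' _ (Finset.mem_univ j) (fun i _ hij => by
        rw [phiJ_left φ J hJ hJφ, hF2 i i.2 j j.2 (fun h => hij (Fin.ext h)), neg_zero])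
    have hr : φ (J (∑ i, c' i • b i)) (b j) = 0 := by
      rw [← hcw]
      exact sum_pair_eq_zero φ _ _ _ _ (fun i _ => hF1 i i.2 j j.2)
    rw [hr] at hl
    exact (mul_eq_zero.mp hl.symm).resolve_right (hF3 j j.2)
  · have h := two_mul_finrank_le_of_isotropic φ hnd W' hW'
    rw [hWn]
    omega

/-- Non-vacuity of the hypotheses (the standard symplectic plane): `K = ℚ`, `V = ℚ × ℚ`,
`φ((a, b), (c, d)) = ad − bc`, `J(a, b) = (−b, a)`, `n = 1`. -/
theorem example_plane :
    ∃ (φ : LinearMap.BilinForm ℚ (ℚ × ℚ)) (J : (ℚ × ℚ) →ₗ[ℚ] (ℚ × ℚ)),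
      (∀ x, φ x x = 0) ∧ (∀ x, x ≠ 0 → ∃ y, φ x y ≠ 0) ∧ (∀ x, J (J x) = -x) ∧
      (∀ x y, φ (J x) (J y) = φ x y) ∧ finrank ℚ (ℚ × ℚ) = 2 * 1 := by
  let φ : LinearMap.BilinForm ℚ (ℚ × ℚ) :=
    LinearMap.mk₂ ℚ (fun x y => x.1 * y.2 - x.2 * y.1)
      (fun x x' y => by simp only [Prod.fst_add, Prod.snd_add]; ring)
      (fun c x y => by simp only [Prod.smul_fst, Prod.smul_snd, smul_eq_mul]; ring)
      (fun x y y' => by simp only [Prod.fst_add, Prod.snd_add]; ring)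
      (fun c x y => by simp only [Prod.smul_fst, Prod.smul_snd, smul_eq_mul]; ring)
  let J : (ℚ × ℚ) →ₗ[ℚ] (ℚ × ℚ) := LinearMap.prod (-LinearMap.snd ℚ ℚ ℚ) (LinearMap.fst ℚ ℚ ℚ)
  have hφ : ∀ x y : ℚ × ℚ, φ x y = x.1 * y.2 - x.2 * y.1 := fun x y => rfl
  have hJ : ∀ x : ℚ × ℚ, J x = (-x.2, x.1) := fun x => rfl
  refine ⟨φ, J, fun x => ?_, fun x hx => ?_, fun x => ?_, fun x y => ?_, ?_⟩
  · rw [hφ]; ring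
  · by_cases h1 : x.1 = 0
    · have h2 : x.2 ≠ 0 := fun h2 => hx (Prod.ext h1 h2)
      exact ⟨(1, 0), by rw [hφ, h1]; simpa using h2⟩
    · exact ⟨(0, 1), by rw [hφ]; simpa using h1⟩
  · rw [hJ, hJ]; ext <;> simp
  · rw [hφ, hφ, hJ, hJ]; ring
  · rw [Module.finrank_prod, Module.finrank_self]

end Frame

end Summit.Ventures.HSemireg.GolyshevLuntsOrlovLagrangian
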